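import Mathlib.Analysis.SpecialFunctions.Gamma.Beta
import Mathlib.Analysis.SpecialFunctions.Pow.Real
import Mathlib.Analysis.SpecialFunctions.Trigonometric.Basic
import Mathlib.Tactic.LinearCombination
import Literature.Analysis.SpecialFunctions.GammaMultiplication
import HarnessLib

/-!
# Das's canonical 2-torsion Gamma monomial on the Fermat surface of degree 15 (proved value)

Topic: `Literature/Analysis/SpecialFunctions`. Das (Trans. AMS 352 (2000), §1 and §9) exhibits
the canonical 2-torsion element `a_{3,5} = [1/3] + [2/15] − [4/15] − [1/5]` of the universal odd
distribution: a Gamma monomial whose SQUARE, but not the monomial itself, is evaluated by the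
reflection and Gauss multiplication formulas ("double coverings of cyclotomic fields"). Up to
reflections this is the Hodge character class `a = (1,6,10,13)` of the degree-15 Fermat surface,
with Deligne's period constant `Γ̃(a) = (2πi)^{-2} Γ(1/15)Γ(6/15)Γ(10/15)Γ(13/15)`
(LNM 900, I §7, Thm. 7.15). This file PROVES the value of the square from Mathlib's reflection
formula and the tree's Gauss multiplication formula (`GaussMultiplication.real_formula`) at
`(n, x) = (3, 1/15), (3, 2/15), (5, 1/15)` — the pub-hlocus engine A relation certificate
`2m = R₂ + R₃ − R₄ + R₅ + D₃,₁ − D₃,₂ + D₅,₁`: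

  `(Γ(1/15)Γ(6/15)Γ(10/15)Γ(13/15))² = 8 π⁴ · 3^{1/5} · 5^{1/6} · sin(4π/15) / (√3 · sin(2π/15) · sin(π/5))`,

and the sign of `Γ̃(a)` (negative real). The values `sin(2π/15)`, `sin(π/5)`, `sin(4π/15)` are left
as they are (elements of `ℚ(ζ₆₀) ∩ ℝ`).

## Sources

* P. Das, *Algebraic Gamma monomials and double coverings of cyclotomic fields*,
  Trans. Amer. Math. Soc. 352 (2000), 3557–3594, §1, §9.
* P. Deligne, *Hodge cycles on abelian varieties*, LNM 900 (1982), I §7, Thm. 7.15.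
* G. E. Andrews, R. Askey, R. Roy, *Special Functions*, CUP 1999, Thm. 1.5.2.
-/

noncomputable section

open scoped Real

namespace Literature.Analysis.SpecialFunctions

/-- `(Γ(1/15)Γ(6/15)Γ(10/15)Γ(13/15))² = 8π⁴·3^{1/5}·5^{1/6}·sin(4π/15)/(√3·sin(2π/15)·sin(π/5))`
(the square of Das's 2-torsion monomial, up to reflections).
[cite: Das2000, §1] [cite: Deligne1982HodgeCycles, I Thm. 7.15] [cite: AndrewsAskeyRoy1999, Thm 1.5.2] -/
theorem Real_Gamma_prod_fermat15_1_6_10_13_sq :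
    (Real.Gamma (1 / 15) * Real.Gamma (6 / 15) * Real.Gamma (10 / 15) * Real.Gamma (13 / 15)) ^ 2 =
      8 * π ^ 4 * (3 : ℝ) ^ ((1 : ℝ) / 5) * (5 : ℝ) ^ ((1 : ℝ) / 6) * Real.sin (4 * π / 15) /
        (Real.sqrt 3 * Real.sin (2 * π / 15) * Real.sin (π / 5)) := by
  rw [show (6 / 15 : ℝ) = 2 / 5 by norm_num, show (10 / 15 : ℝ) = 2 / 3 by norm_num]
  -- reflections
  have hR2 := Real.Gamma_mul_Gamma_one_sub (2 / 15 : ℝ)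
  rw [show (1 : ℝ) - 2 / 15 = 13 / 15 by norm_num, show π * (2 / 15 : ℝ) = 2 * π / 15 by ring] at hR2
  have hR3 := Real.Gamma_mul_Gamma_one_sub (1 / 5 : ℝ)
  rw [show (1 : ℝ) - 1 / 5 = 4 / 5 by norm_num, show π * (1 / 5 : ℝ) = π / 5 by ring] at hR3
  have hR4 := Real.Gamma_mul_Gamma_one_sub (4 / 15 : ℝ)
  rw [show (1 : ℝ) - 4 / 15 = 11 / 15 by norm_num, show π * (4 / 15 : ℝ) = 4 * π / 15 by ring] at hR4
  have hR5 := Real.Gamma_mul_Gamma_one_sub (1 / 3 : ℝ)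
  rw [show (1 : ℝ) - 1 / 3 = 2 / 3 by norm_num, show π * (1 / 3 : ℝ) = π / 3 by ring,
    Real.sin_pi_div_three] at hR5
  -- Gauss multiplication: n = 3 at x = 1/15 and x = 2/15, n = 5 at x = 1/15
  have h31 := GaussMultiplication.real_formula (n := 3) (by norm_num) (show (0 : ℝ) < 1 / 15 by norm_num)
  simp only [GaussMultiplication.prodGamma, Finset.prod_range_succ, Finset.prod_range_zero, one_mul,
    Nat.cast_zero, Nat.cast_one, Nat.cast_ofNat, zero_div, add_zero] at h31
  norm_num at h31
  have h32 := GaussMultiplication.real_formula (n := 3) (by norm_num) (show (0 : ℝ) < 2 / 15 by norm_num)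
  simp only [GaussMultiplication.prodGamma, Finset.prod_range_succ, Finset.prod_range_zero, one_mul,
    Nat.cast_zero, Nat.cast_one, Nat.cast_ofNat, zero_div, add_zero] at h32
  norm_num at h32
  rw [show (3 : ℝ) ^ ((2 : ℝ) / 5) = (3 : ℝ) ^ ((1 : ℝ) / 5) * (3 : ℝ) ^ ((1 : ℝ) / 5) by
    rw [← Real.rpow_add (by norm_num : (0 : ℝ) < 3)]; norm_num] at h32
  have h51 := GaussMultiplication.real_formula (n := 5) (by norm_num) (show (0 : ℝ) < 1 / 15 by norm_num)
  simp only [GaussMultiplication.prodGamma, Finset.prod_range_succ, Finset.prod_range_zero, one_mul,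
    Nat.cast_zero, Nat.cast_one, Nat.cast_ofNat, zero_div, add_zero] at h51
  norm_num at h51
  rw [show Real.sqrt 5 = (5 : ℝ) ^ ((1 : ℝ) / 3) * (5 : ℝ) ^ ((1 : ℝ) / 6) by
    rw [Real.sqrt_eq_rpow, ← Real.rpow_add (by norm_num : (0 : ℝ) < 5)]; norm_num] at h51
  -- nonvanishing
  have hs2 : 0 < Real.sin (2 * π / 15) :=
    Real.sin_pos_of_pos_of_lt_pi (by positivity) (by linarith [Real.pi_pos])
  have hs3 : 0 < Real.sin (π / 5) :=
    Real.sin_pos_of_pos_of_lt_pi (by positivity) (by linarith [Real.pi_pos])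
  have hs4 : 0 < Real.sin (4 * π / 15) :=
    Real.sin_pos_of_pos_of_lt_pi (by positivity) (by linarith [Real.pi_pos])
  have hG3 := (Real.Gamma_pos_of_pos (by norm_num : (0 : ℝ) < 1 / 5)).ne'
  have hG5 := (Real.Gamma_pos_of_pos (by norm_num : (0 : ℝ) < 1 / 3)).ne'
  have hG6 := (Real.Gamma_pos_of_pos (by norm_num : (0 : ℝ) < 2 / 5)).ne'
  have hu : (5 : ℝ) ^ ((1 : ℝ) / 3) ≠ 0 := (Real.rpow_pos_of_pos (by norm_num) _).ne'
  set G1 := Real.Gamma (1 / 15)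
  set G2 := Real.Gamma (2 / 15)
  set G3 := Real.Gamma (1 / 5)
  set G4 := Real.Gamma (4 / 15)
  set G5 := Real.Gamma (1 / 3)
  set G6 := Real.Gamma (2 / 5)
  set G7 := Real.Gamma (7 / 15)
  set G10 := Real.Gamma (2 / 3)
  set G11 := Real.Gamma (11 / 15)
  set G12 := Real.Gamma (4 / 5)
  set G13 := Real.Gamma (13 / 15)
  set t := (3 : ℝ) ^ ((1 : ℝ) / 5)
  set u := (5 : ℝ) ^ ((1 : ℝ) / 3)
  set v := (5 : ℝ) ^ ((1 : ℝ) / 6)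
  set s2 := Real.sin (2 * π / 15)
  set s3 := Real.sin (π / 5)
  set s4 := Real.sin (4 * π / 15)
  -- relation certificate 2m = R₂ + R₃ − R₄ + R₅ + D₃,₁ − D₃,₂ + D₅,₁ as a monomial identity
  have key : (G1 * G6 * G10 * G13) ^ 2 * ((G4 * G11) * (G2 * G7 * G12 * (t * t)) * G3 * G5 * u) =
      (G2 * G13) * (G3 * G12) * (G5 * G10) * (G1 * G6 * G11 * t) * (G1 * G4 * G7 * G10 * G13 * u) *
        G6 * t := by ring
  rw [hR4, h32, hR2, hR3, hR5, h31, h51] at key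
  have hX : π / s4 * (G6 * Real.sqrt 3 * (2 * π)) * G3 * G5 * u ≠ 0 := by
    have := hs4.ne'
    positivity
  rw [eq_div_of_mul_eq hX key]
  have := hs2.ne'; have := hs3.ne'; have := hs4.ne'
  field_simp
  ring

/-- The sign: in `ℂ`, `Γ̃(1,6,10,13) = Γ(1/15)Γ(6/15)Γ(10/15)Γ(13/15)/(2πi)² = −P/(4π²)` is a NEGATIVE real
number, `P > 0`. [cite: Deligne1982HodgeCycles, I Thm. 7.15] -/
theorem Complex_gammaTilde_fermat15_1_6_10_13 :
    ((Real.Gamma (1 / 15) * Real.Gamma (6 / 15) * Real.Gamma (10 / 15) * Real.Gamma (13 / 15) : ℝ) : ℂ) /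
        (2 * π * Complex.I) ^ 2 =
      -((Real.Gamma (1 / 15) * Real.Gamma (6 / 15) * Real.Gamma (10 / 15) * Real.Gamma (13 / 15) /
          (4 * π ^ 2) : ℝ) : ℂ) ∧
    0 < Real.Gamma (1 / 15) * Real.Gamma (6 / 15) * Real.Gamma (10 / 15) * Real.Gamma (13 / 15) := by
  refine ⟨?_, ?_⟩
  · have hden : (2 * (π : ℂ) * Complex.I) ^ 2 = -(4 * (π : ℂ) ^ 2) := by
      linear_combination (4 * (π : ℂ) ^ 2) * Complex.I_sq
    have hpi : (π : ℂ) ≠ 0 := Complex.ofReal_ne_zero.mpr Real.pi_pos.ne'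
    rw [hden]
    push_cast
    field_simp
  · have := Real.Gamma_pos_of_pos (by norm_num : (0 : ℝ) < 1 / 15)
    have := Real.Gamma_pos_of_pos (by norm_num : (0 : ℝ) < 6 / 15)
    have := Real.Gamma_pos_of_pos (by norm_num : (0 : ℝ) < 10 / 15)
    have := Real.Gamma_pos_of_pos (by norm_num : (0 : ℝ) < 13 / 15)
    positivity

end Literature.Analysis.SpecialFunctions
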